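import Summits.Parity.GeneralizedHardyLittlewood.Theorems.PrimeLevelFamEdgeMomentsBeyondDiagonalDiagDecorTau2
import Summits.Parity.GeneralizedHardyLittlewood.Theorems.PrimeLevelFamEdgeMomentsBeyondDiagonalDiagDecorMonomial
import HarnessLib

/-!
# Route `PrimeLevelFamEdge`, crux K_A `MomentsBeyondDiagonal` (stmt-Parity-20007), line «petersson_layers» v4, stub `stub_diag`:
# **the order-`(1,1)` WEIGHT ALGEBRA: the Hecke-divisor sums `Σ_{d∣k₁}Σ_{e∣k₂}` of the four Bose pieces in CLOSED FORM**

Census R3(ii), ALGEBRAIC HALF (item (b) of `Cruxes/MomentsBeyondDiagonal/Lines/petersson_layers_stub_diag_g9_decor.md`,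
in a closed form that replaces the announced five-variable expansion). In the decorated Selberg coordinates of
`…DiagOrderSelberg` (p821962) the order-`(1,1)` weight is, after `…DiagOrderSplit.selbergForm_bose_expand`,
`Σ_{a,b≤1} A₁^{1−a}A₂^{1−b}·c_{ab}(n₁n₂/Q²)` with `A₁ = log(Q/n₁)`, `A₂ = log(Q/n₂)`, `n₁ = (k₁/d)(ge)`, `n₂ = (gd)(k₂/e)`.
The KEY REMARK: `n₁n₂ = g²k₁k₂` does not see `(d,e)`, so every `c_{ab}(n₁n₂/Q²)` — and every function of
`L = A₁ + A₂ = log(Q²/(g²k₁k₂)) = 2X − log k₁ − log k₂`, `X = log Q − log g` — is a CONSTANT of the `(d,e)`-summation, and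
only `Σ_{d,e}1`, `Σ_{d,e}A₁`, `Σ_{d,e}A₂`, `Σ_{d,e}A₁A₂` are needed (`τ = #divisors`, `τ_{1,1}(k) = Σ_{d∣k}log d·log(k/d)`,
`P₂(k) = Σ_{p∣k}log²p`):

* `sum_divisors_const_sub_log`, `sum_divisors_const_sub_log_div` — `Σ_{d∣k}(X − log d) = Σ_{d∣k}(X − log(k/d)) = τ(k)(X − ½log k)`;
* `sum_divisors_sum_divisors_A1`, `…_A2` — **`Σ_{d,e}A₁ = Σ_{d,e}A₂ = τ(k₁)τ(k₂)·L/2`**;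
* `sum_divisors_sum_divisors_A1_mul_A2` — **`Σ_{d,e}A₁A₂ = τ(k₁)τ(k₂)(X² − X·log(k₁k₂) + ½log k₁log k₂) + τ(k₂)τ_{1,1}(k₁) + τ(k₁)τ_{1,1}(k₂)`**,
  `…_eq_L` — the same as `τ(k₁)τ(k₂)(L²/4 − (log²k₁ + log²k₂)/4) + τ(k₂)τ_{1,1}(k₁) + τ(k₁)τ_{1,1}(k₂)`, and
  `…_of_squarefree` — **`= τ(k₁)τ(k₂)·(L²/4 − (P₂(k₁) + P₂(k₂))/4)`** for squarefree `k₁, k₂` (`…DiagDecorMult.tau11_eq_of_squarefree`);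
* bridges to the Selberg form: `log_Q_div_n1_eq`, `log_Q_div_n2_eq` (`A₁ = X − log e − log(k₁/d)`, `A₂ = X − log d − log(k₂/e)`),
  `n1_mul_n2_eq` (`n₁n₂ = g²(k₁k₂)` in `ℕ`), and the four INNER-SUM IDENTITIES with an arbitrary `(d,e)`-free factor `H(n₁n₂)`:
  `inner_weight_one` (`Σ_{d,e}H = ττ·H(g²k₁k₂)`), `inner_weight_A1`, `inner_weight_A2` (`= ττ·(L/2)·H(g²k₁k₂)`),
  `inner_weight_A1A2` / `inner_weight_A1A2_of_squarefree` (`= ττ(L²/4 − ΣP₂/4)·H(g²k₁k₂)`);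
* `selbergForm_congr_squarefree` — inside the Selberg form only squarefree `k₁, k₂` count (`μ(cgk) = 0` otherwise), so the
  squarefree forms may be substituted under `Σ_cΣ_g μ(g)c Σ_{k₁,k₂} y′y′(…)`.

Consequence (the whole polynomial part of the order-`(1,1)` target, with `c_{01} = c_{10}` of `…DiagBoseSymm`):
`Σ_{d,e}𝔚₁₁ = τ(k₁)τ(k₂)·{(L²/4 − (P₂(k₁)+P₂(k₂))/4)·c₀₀ + L·c₀₁ + c₁₁}(g²k₁k₂/Q²)` on squarefree `k₁,k₂`; with
`c_{ab} = Π_{ab}(L) + E_{ab} + r_{ab}` (`…DiagBoseMixedStructure`: `Π₀₀ = L/2`, `Π₀₁ = −L²/8`, `Π₁₁ = L³/24 − 2μ₂L`) the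
polynomial part is `ττ·[L³/24 + (E₀₀/4)L² + (E₀₁−2μ₂)L + E₁₁ − (P₂(k₁)+P₂(k₂))(L/8 + E₀₀/4)]`, i.e. ONLY the monomial families
`τ(k₁)τ(k₂)L^m` (`m ≤ 3`) and `τ(k₁)τ(k₂)P₂(k₁)L^m` (`m ≤ 1`) of the engines `…DiagDecorLogPow` / `…DiagDecorPrimeSq` occur —
no `τ_{1,0}`, `τ_{1,1}`, `τ_{2,0}` coordinates are needed at order `(1,1)`. (Hand check, not used here: with
`Sel(ττL^m) ≈ (π²/6)²Φ_m log^{m−3}M` this reproduces `τ₁₁ = B₁₁/2 = ½[(P′(1)+Δ′P(1))² + ∫P″²/(3Δ′)]` of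
`Lines/petersson_layers_stub_diag_g8_orders.md`.)

Def-free; theorems only. Helper `--supports stmt-Parity-20007`; closes nothing; K_A, K_B and the Parity summit are NOT
proved; nothing about Landau–Siegel zeros.

## References
* E. Kowalski, P. Michel, J. VanderKam, J. reine angew. Math. 526 (2000), (21)–(28) pp. 12–15.
  [cite: KowalskiMichelVanderKam2000, (23)–(28) — derivation (Hecke-divisor bookkeeping of the order-(1,1) diagonal weight)]
-/

noncomputable section

open scoped Real ArithmeticFunction.Moebius
open Finset ArithmeticFunction Polynomial

namespace Summit.Parity.GeneralizedHardyLittlewood.Theorems.MomentsBeyondDiagonal.DiagKernel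

open Literature.NumberTheory.LFunctions Literature.NumberTheory.LFunctions.KMV2000
open Summit.Parity.GeneralizedHardyLittlewood.Theorems.MomentsBeyondDiagonal.DiagLines
  (sum_divisors_log_eq tau11_eq_of_squarefree)

/-! ### One-variable divisor sums -/

/-- `log d + log(k/d) = log k` for `d ∣ k`, `k ≥ 1` (real logarithms of naturals). [folklore] -/
theorem log_add_log_div_of_mem_divisors {k d : ℕ} (hd : d ∈ k.divisors) :
    Real.log d + Real.log ((k / d : ℕ) : ℝ) = Real.log k := by
  have hk : k ≠ 0 := (Nat.mem_divisors.1 hd).2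
  have hdk : d ∣ k := (Nat.mem_divisors.1 hd).1
  have hd0 : d ≠ 0 := by rintro rfl; exact hk (zero_dvd_iff.1 hdk)
  have hq0 : k / d ≠ 0 := fun h ↦ hk (Nat.eq_zero_of_dvd_of_div_eq_zero hdk h)
  rw [← Real.log_mul (by exact_mod_cast hd0) (by exact_mod_cast hq0)]
  congr 1
  exact_mod_cast Nat.mul_div_cancel' hdk

/-- `Σ_{d∣k}(X − log d) = τ(k)·(X − ½log k)` (`k ≥ 1`). [folklore] -/
theorem sum_divisors_const_sub_log (X : ℝ) {k : ℕ} (hk : k ≠ 0) :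
    ∑ d ∈ k.divisors, (X - Real.log d) = (k.divisors.card : ℝ) * (X - Real.log k / 2) := by
  rw [Finset.sum_sub_distrib, Finset.sum_const, nsmul_eq_mul, sum_divisors_log_eq hk]
  ring

/-- `Σ_{d∣k}(X − log(k/d)) = τ(k)·(X − ½log k)` (`k ≥ 1`). [folklore] -/
theorem sum_divisors_const_sub_log_div (X : ℝ) {k : ℕ} (hk : k ≠ 0) :
    ∑ d ∈ k.divisors, (X - Real.log ((k / d : ℕ) : ℝ)) = (k.divisors.card : ℝ) * (X - Real.log k / 2) := by
  rw [Nat.sum_div_divisors k (fun d ↦ X - Real.log (d : ℝ))]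
  exact sum_divisors_const_sub_log X hk

/-- `Σ_{d∣k} log(k/d) = ½τ(k)log k` (`k ≥ 1`; `τ_{0,1} = τ_{1,0}`). [folklore] -/
theorem sum_divisors_log_div_eq {k : ℕ} (hk : k ≠ 0) :
    ∑ d ∈ k.divisors, Real.log ((k / d : ℕ) : ℝ) = (k.divisors.card : ℝ) * Real.log k / 2 := by
  rw [Nat.sum_div_divisors k (fun d ↦ Real.log (d : ℝ))]
  exact sum_divisors_log_eq hk

/-! ### The two-variable Hecke-divisor sums of the order-`(1,1)` weight -/

/-- **`Σ_{d∣k₁}Σ_{e∣k₂} A₁ = τ(k₁)τ(k₂)·L/2`** with `A₁ = X − log e − log(k₁/d)`, `L = 2X − log k₁ − log k₂` (`k₁,k₂ ≥ 1`).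
[cite: KowalskiMichelVanderKam2000, (23)–(28) — derivation] -/
theorem sum_divisors_sum_divisors_A1 (X : ℝ) {k₁ k₂ : ℕ} (hk₁ : k₁ ≠ 0) (hk₂ : k₂ ≠ 0) :
    ∑ d ∈ k₁.divisors, ∑ e ∈ k₂.divisors, (X - Real.log e - Real.log ((k₁ / d : ℕ) : ℝ)) =
      (k₁.divisors.card : ℝ) * (k₂.divisors.card : ℝ) * ((2 * X - Real.log k₁ - Real.log k₂) / 2) := by
  have hinner : ∀ d ∈ k₁.divisors, ∑ e ∈ k₂.divisors, (X - Real.log e - Real.log ((k₁ / d : ℕ) : ℝ)) =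
      (k₂.divisors.card : ℝ) * ((X - Real.log ((k₁ / d : ℕ) : ℝ)) - Real.log k₂ / 2) := by
    intro d _
    have h := sum_divisors_const_sub_log (X - Real.log ((k₁ / d : ℕ) : ℝ)) hk₂
    rw [← h]
    exact Finset.sum_congr rfl fun e _ ↦ by ring
  rw [Finset.sum_congr rfl hinner, ← Finset.mul_sum, Finset.sum_sub_distrib, Finset.sum_const, nsmul_eq_mul,
    sum_divisors_const_sub_log_div X hk₁]
  ring

/-- **`Σ_{d∣k₁}Σ_{e∣k₂} A₂ = τ(k₁)τ(k₂)·L/2`** with `A₂ = X − log d − log(k₂/e)`, `L = 2X − log k₁ − log k₂` (`k₁,k₂ ≥ 1`).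
[cite: KowalskiMichelVanderKam2000, (23)–(28) — derivation] -/
theorem sum_divisors_sum_divisors_A2 (X : ℝ) {k₁ k₂ : ℕ} (hk₁ : k₁ ≠ 0) (hk₂ : k₂ ≠ 0) :
    ∑ d ∈ k₁.divisors, ∑ e ∈ k₂.divisors, (X - Real.log d - Real.log ((k₂ / e : ℕ) : ℝ)) =
      (k₁.divisors.card : ℝ) * (k₂.divisors.card : ℝ) * ((2 * X - Real.log k₁ - Real.log k₂) / 2) := by
  have hinner : ∀ d ∈ k₁.divisors, ∑ e ∈ k₂.divisors, (X - Real.log d - Real.log ((k₂ / e : ℕ) : ℝ)) =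
      (k₂.divisors.card : ℝ) * ((X - Real.log d) - Real.log k₂ / 2) := by
    intro d _
    have h := sum_divisors_const_sub_log_div (X - Real.log d) hk₂
    rw [← h]
  rw [Finset.sum_congr rfl hinner, ← Finset.mul_sum, Finset.sum_sub_distrib, Finset.sum_const, nsmul_eq_mul,
    sum_divisors_const_sub_log X hk₁]
  ring

/-- **`Σ_{d∣k₁}Σ_{e∣k₂} A₁A₂ = τ(k₁)τ(k₂)·(X² − X(log k₁ + log k₂) + ½log k₁log k₂) + τ(k₂)·τ_{1,1}(k₁) + τ(k₁)·τ_{1,1}(k₂)`**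
(`A₁ = X − log e − log(k₁/d)`, `A₂ = X − log d − log(k₂/e)`, `τ_{1,1}(k) = Σ_{d∣k}log d·log(k/d)`; `k₁,k₂ ≥ 1`).
[cite: KowalskiMichelVanderKam2000, (23)–(28) — derivation] -/
theorem sum_divisors_sum_divisors_A1_mul_A2 (X : ℝ) {k₁ k₂ : ℕ} (hk₁ : k₁ ≠ 0) (hk₂ : k₂ ≠ 0) :
    ∑ d ∈ k₁.divisors, ∑ e ∈ k₂.divisors,
        (X - Real.log e - Real.log ((k₁ / d : ℕ) : ℝ)) * (X - Real.log d - Real.log ((k₂ / e : ℕ) : ℝ)) =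
      (k₁.divisors.card : ℝ) * (k₂.divisors.card : ℝ) *
          (X ^ 2 - X * (Real.log k₁ + Real.log k₂) + Real.log k₁ * Real.log k₂ / 2) +
        (k₂.divisors.card : ℝ) * (∑ d ∈ k₁.divisors, Real.log d * Real.log ((k₁ / d : ℕ) : ℝ)) +
        (k₁.divisors.card : ℝ) * (∑ e ∈ k₂.divisors, Real.log e * Real.log ((k₂ / e : ℕ) : ℝ)) := by
  -- pointwise: use `log d + log(k₁/d) = log k₁`, `log e + log(k₂/e) = log k₂`
  have hpt : ∀ d ∈ k₁.divisors, ∀ e ∈ k₂.divisors,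
      (X - Real.log e - Real.log ((k₁ / d : ℕ) : ℝ)) * (X - Real.log d - Real.log ((k₂ / e : ℕ) : ℝ)) =
        (X ^ 2 - X * (Real.log k₁ + Real.log k₂)) + Real.log d * Real.log ((k₁ / d : ℕ) : ℝ) +
          Real.log e * Real.log ((k₂ / e : ℕ) : ℝ) +
          (Real.log ((k₁ / d : ℕ) : ℝ) * Real.log ((k₂ / e : ℕ) : ℝ) + Real.log d * Real.log e) := by
    intro d hd e he
    rw [← log_add_log_div_of_mem_divisors hd, ← log_add_log_div_of_mem_divisors he]
    ring
  rw [Finset.sum_congr rfl fun d hd ↦ Finset.sum_congr rfl fun e he ↦ hpt d hd e he]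
  -- distribute the double sum
  have hdist : ∑ d ∈ k₁.divisors, ∑ e ∈ k₂.divisors,
      ((X ^ 2 - X * (Real.log k₁ + Real.log k₂)) + Real.log d * Real.log ((k₁ / d : ℕ) : ℝ) +
          Real.log e * Real.log ((k₂ / e : ℕ) : ℝ) +
          (Real.log ((k₁ / d : ℕ) : ℝ) * Real.log ((k₂ / e : ℕ) : ℝ) + Real.log d * Real.log e)) =
      (k₁.divisors.card : ℝ) * (k₂.divisors.card : ℝ) * (X ^ 2 - X * (Real.log k₁ + Real.log k₂)) +
        (k₂.divisors.card : ℝ) * (∑ d ∈ k₁.divisors, Real.log d * Real.log ((k₁ / d : ℕ) : ℝ)) +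
        (k₁.divisors.card : ℝ) * (∑ e ∈ k₂.divisors, Real.log e * Real.log ((k₂ / e : ℕ) : ℝ)) +
        ((∑ d ∈ k₁.divisors, Real.log ((k₁ / d : ℕ) : ℝ)) * (∑ e ∈ k₂.divisors, Real.log ((k₂ / e : ℕ) : ℝ)) +
          (∑ d ∈ k₁.divisors, Real.log d) * (∑ e ∈ k₂.divisors, Real.log e)) := by
    simp only [Finset.sum_add_distrib, Finset.sum_const, nsmul_eq_mul, ← Finset.mul_sum, ← Finset.sum_mul]
    ring
  rw [hdist, sum_divisors_log_div_eq hk₁, sum_divisors_log_div_eq hk₂, sum_divisors_log_eq hk₁,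
    sum_divisors_log_eq hk₂]
  ring

/-- The same in terms of `L = 2X − log k₁ − log k₂`:
**`Σ_{d,e}A₁A₂ = τ(k₁)τ(k₂)·(L²/4 − (log²k₁ + log²k₂)/4) + τ(k₂)τ_{1,1}(k₁) + τ(k₁)τ_{1,1}(k₂)`**.
[cite: KowalskiMichelVanderKam2000, (23)–(28) — derivation] -/
theorem sum_divisors_sum_divisors_A1_mul_A2_eq_L (X : ℝ) {k₁ k₂ : ℕ} (hk₁ : k₁ ≠ 0) (hk₂ : k₂ ≠ 0) :
    ∑ d ∈ k₁.divisors, ∑ e ∈ k₂.divisors,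
        (X - Real.log e - Real.log ((k₁ / d : ℕ) : ℝ)) * (X - Real.log d - Real.log ((k₂ / e : ℕ) : ℝ)) =
      (k₁.divisors.card : ℝ) * (k₂.divisors.card : ℝ) *
          ((2 * X - Real.log k₁ - Real.log k₂) ^ 2 / 4 - (Real.log k₁ ^ 2 + Real.log k₂ ^ 2) / 4) +
        (k₂.divisors.card : ℝ) * (∑ d ∈ k₁.divisors, Real.log d * Real.log ((k₁ / d : ℕ) : ℝ)) +
        (k₁.divisors.card : ℝ) * (∑ e ∈ k₂.divisors, Real.log e * Real.log ((k₂ / e : ℕ) : ℝ)) := by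
  rw [sum_divisors_sum_divisors_A1_mul_A2 X hk₁ hk₂]
  ring

/-- **Squarefree form: `Σ_{d,e}A₁A₂ = τ(k₁)τ(k₂)·(L²/4 − (P₂(k₁) + P₂(k₂))/4)`**, `P₂(k) = Σ_{p∣k}log²p`
(`τ_{1,1} = τ(log² − P₂)/4` on squarefree numbers). [cite: KowalskiMichelVanderKam2000, (23)–(28) — derivation] -/
theorem sum_divisors_sum_divisors_A1_mul_A2_of_squarefree (X : ℝ) {k₁ k₂ : ℕ} (hk₁ : Squarefree k₁)
    (hk₂ : Squarefree k₂) :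
    ∑ d ∈ k₁.divisors, ∑ e ∈ k₂.divisors,
        (X - Real.log e - Real.log ((k₁ / d : ℕ) : ℝ)) * (X - Real.log d - Real.log ((k₂ / e : ℕ) : ℝ)) =
      (k₁.divisors.card : ℝ) * (k₂.divisors.card : ℝ) *
        ((2 * X - Real.log k₁ - Real.log k₂) ^ 2 / 4 -
          ((∑ p ∈ k₁.primeFactors, Real.log p ^ 2) + ∑ p ∈ k₂.primeFactors, Real.log p ^ 2) / 4) := by
  rw [sum_divisors_sum_divisors_A1_mul_A2_eq_L X hk₁.ne_zero hk₂.ne_zero, tau11_eq_of_squarefree hk₁,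
    tau11_eq_of_squarefree hk₂]
  ring

/-! ### Bridges to the decorated Selberg form (`n₁ = (k₁/d)(ge)`, `n₂ = (gd)(k₂/e)`) -/

/-- `n₁n₂ = g²·(k₁k₂)` in `ℕ` for `d ∣ k₁`, `e ∣ k₂`. [folklore] -/
theorem n1_mul_n2_eq {k₁ k₂ d e : ℕ} (g : ℕ) (hd : d ∈ k₁.divisors) (he : e ∈ k₂.divisors) :
    k₁ / d * (g * e) * (g * d * (k₂ / e)) = g * g * (k₁ * k₂) := by
  have hdk : d ∣ k₁ := (Nat.mem_divisors.1 hd).1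
  have hek : e ∣ k₂ := (Nat.mem_divisors.1 he).1
  calc k₁ / d * (g * e) * (g * d * (k₂ / e)) = g * g * ((k₁ / d * d) * (k₂ / e * e)) := by ring
    _ = g * g * (k₁ * k₂) := by rw [Nat.div_mul_cancel hdk, Nat.div_mul_cancel hek]

/-- `A₁ = log(Q/n₁) = (log Q − log g) − log e − log(k₁/d)` (`Q > 0`, `g ≥ 1`, `d ∣ k₁`, `e ∣ k₂`). [folklore] -/
theorem log_Q_div_n1_eq {Q : ℝ} (hQ : 0 < Q) {g k₁ k₂ d e : ℕ} (hg : g ≠ 0) (hd : d ∈ k₁.divisors)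
    (he : e ∈ k₂.divisors) :
    Real.log (Q / ((k₁ / d * (g * e) : ℕ) : ℝ)) =
      (Real.log Q - Real.log g) - Real.log e - Real.log ((k₁ / d : ℕ) : ℝ) := by
  have hk₁ : k₁ ≠ 0 := (Nat.mem_divisors.1 hd).2
  have hk₂ : k₂ ≠ 0 := (Nat.mem_divisors.1 he).2
  have hdk : d ∣ k₁ := (Nat.mem_divisors.1 hd).1
  have hek : e ∣ k₂ := (Nat.mem_divisors.1 he).1
  have he0 : e ≠ 0 := by rintro rfl; exact hk₂ (zero_dvd_iff.1 hek)
  have hq0 : k₁ / d ≠ 0 := fun h ↦ hk₁ (Nat.eq_zero_of_dvd_of_div_eq_zero hdk h)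
  have h1 : ((k₁ / d : ℕ) : ℝ) ≠ 0 := by exact_mod_cast hq0
  have h2 : (g : ℝ) ≠ 0 := by exact_mod_cast hg
  have h3 : (e : ℝ) ≠ 0 := by exact_mod_cast he0
  push_cast
  rw [Real.log_div hQ.ne' (by positivity), Real.log_mul h1 (mul_ne_zero h2 h3), Real.log_mul h2 h3]
  ring

/-- `A₂ = log(Q/n₂) = (log Q − log g) − log d − log(k₂/e)` (`Q > 0`, `g ≥ 1`, `d ∣ k₁`, `e ∣ k₂`). [folklore] -/
theorem log_Q_div_n2_eq {Q : ℝ} (hQ : 0 < Q) {g k₁ k₂ d e : ℕ} (hg : g ≠ 0) (hd : d ∈ k₁.divisors)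
    (he : e ∈ k₂.divisors) :
    Real.log (Q / ((g * d * (k₂ / e) : ℕ) : ℝ)) =
      (Real.log Q - Real.log g) - Real.log d - Real.log ((k₂ / e : ℕ) : ℝ) := by
  have hk₁ : k₁ ≠ 0 := (Nat.mem_divisors.1 hd).2
  have hk₂ : k₂ ≠ 0 := (Nat.mem_divisors.1 he).2
  have hdk : d ∣ k₁ := (Nat.mem_divisors.1 hd).1
  have hek : e ∣ k₂ := (Nat.mem_divisors.1 he).1
  have hd0 : d ≠ 0 := by rintro rfl; exact hk₁ (zero_dvd_iff.1 hdk)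
  have hq0 : k₂ / e ≠ 0 := fun h ↦ hk₂ (Nat.eq_zero_of_dvd_of_div_eq_zero hek h)
  have h1 : ((k₂ / e : ℕ) : ℝ) ≠ 0 := by exact_mod_cast hq0
  have h2 : (g : ℝ) ≠ 0 := by exact_mod_cast hg
  have h3 : (d : ℝ) ≠ 0 := by exact_mod_cast hd0
  push_cast
  rw [Real.log_div hQ.ne' (by positivity), Real.log_mul (mul_ne_zero h2 h3) h1, Real.log_mul h2 h3]
  ring

/-! ### The four inner-sum identities (arbitrary `(d,e)`-free factor `H(n₁n₂)`) -/

/-- Piece `(a,b) = (1,1)`: **`Σ_{d,e} H(n₁n₂) = τ(k₁)τ(k₂)·H(g²k₁k₂)`** (every `g, k₁, k₂`).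
[cite: KowalskiMichelVanderKam2000, (23)–(28) — derivation] -/
theorem inner_weight_one (H : ℕ → ℝ) (g k₁ k₂ : ℕ) :
    ∑ d ∈ k₁.divisors, ∑ e ∈ k₂.divisors, H (k₁ / d * (g * e) * (g * d * (k₂ / e))) =
      (k₁.divisors.card : ℝ) * (k₂.divisors.card : ℝ) * H (g * g * (k₁ * k₂)) := by
  rw [Finset.sum_congr rfl fun d hd ↦ Finset.sum_congr rfl fun e he ↦ by rw [n1_mul_n2_eq g hd he],
    Finset.sum_const, Finset.sum_const, smul_smul, nsmul_eq_mul]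
  push_cast
  ring

/-- Piece `(a,b) = (0,1)`: **`Σ_{d,e} log(Q/n₁)·H(n₁n₂) = τ(k₁)τ(k₂)·(L/2)·H(g²k₁k₂)`**, `L = 2(log Q − log g) − log k₁ − log k₂`
(`Q > 0`, `g, k₁, k₂ ≥ 1`). [cite: KowalskiMichelVanderKam2000, (23)–(28) — derivation] -/
theorem inner_weight_A1 (H : ℕ → ℝ) {Q : ℝ} (hQ : 0 < Q) {g k₁ k₂ : ℕ} (hg : g ≠ 0) (hk₁ : k₁ ≠ 0) (hk₂ : k₂ ≠ 0) :
    ∑ d ∈ k₁.divisors, ∑ e ∈ k₂.divisors,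
        Real.log (Q / ((k₁ / d * (g * e) : ℕ) : ℝ)) * H (k₁ / d * (g * e) * (g * d * (k₂ / e))) =
      (k₁.divisors.card : ℝ) * (k₂.divisors.card : ℝ) *
        ((2 * (Real.log Q - Real.log g) - Real.log k₁ - Real.log k₂) / 2) * H (g * g * (k₁ * k₂)) := by
  rw [Finset.sum_congr rfl fun d hd ↦ Finset.sum_congr rfl fun e he ↦ by
    rw [n1_mul_n2_eq g hd he, log_Q_div_n1_eq hQ hg hd he]]
  simp_rw [← Finset.sum_mul]
  rw [sum_divisors_sum_divisors_A1 _ hk₁ hk₂]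

/-- Piece `(a,b) = (1,0)`: **`Σ_{d,e} log(Q/n₂)·H(n₁n₂) = τ(k₁)τ(k₂)·(L/2)·H(g²k₁k₂)`** (`Q > 0`, `g, k₁, k₂ ≥ 1`).
[cite: KowalskiMichelVanderKam2000, (23)–(28) — derivation] -/
theorem inner_weight_A2 (H : ℕ → ℝ) {Q : ℝ} (hQ : 0 < Q) {g k₁ k₂ : ℕ} (hg : g ≠ 0) (hk₁ : k₁ ≠ 0) (hk₂ : k₂ ≠ 0) :
    ∑ d ∈ k₁.divisors, ∑ e ∈ k₂.divisors,
        Real.log (Q / ((g * d * (k₂ / e) : ℕ) : ℝ)) * H (k₁ / d * (g * e) * (g * d * (k₂ / e))) =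
      (k₁.divisors.card : ℝ) * (k₂.divisors.card : ℝ) *
        ((2 * (Real.log Q - Real.log g) - Real.log k₁ - Real.log k₂) / 2) * H (g * g * (k₁ * k₂)) := by
  rw [Finset.sum_congr rfl fun d hd ↦ Finset.sum_congr rfl fun e he ↦ by
    rw [n1_mul_n2_eq g hd he, log_Q_div_n2_eq hQ hg hd he]]
  simp_rw [← Finset.sum_mul]
  rw [sum_divisors_sum_divisors_A2 _ hk₁ hk₂]

/-- Piece `(a,b) = (0,0)`: **`Σ_{d,e} log(Q/n₁)log(Q/n₂)·H(n₁n₂) =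
[τ(k₁)τ(k₂)(L²/4 − (log²k₁+log²k₂)/4) + τ(k₂)τ_{1,1}(k₁) + τ(k₁)τ_{1,1}(k₂)]·H(g²k₁k₂)`** (`Q > 0`, `g, k₁, k₂ ≥ 1`).
[cite: KowalskiMichelVanderKam2000, (23)–(28) — derivation] -/
theorem inner_weight_A1A2 (H : ℕ → ℝ) {Q : ℝ} (hQ : 0 < Q) {g k₁ k₂ : ℕ} (hg : g ≠ 0) (hk₁ : k₁ ≠ 0)
    (hk₂ : k₂ ≠ 0) :
    ∑ d ∈ k₁.divisors, ∑ e ∈ k₂.divisors,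
        Real.log (Q / ((k₁ / d * (g * e) : ℕ) : ℝ)) * Real.log (Q / ((g * d * (k₂ / e) : ℕ) : ℝ)) *
          H (k₁ / d * (g * e) * (g * d * (k₂ / e))) =
      ((k₁.divisors.card : ℝ) * (k₂.divisors.card : ℝ) *
          ((2 * (Real.log Q - Real.log g) - Real.log k₁ - Real.log k₂) ^ 2 / 4 -
            (Real.log k₁ ^ 2 + Real.log k₂ ^ 2) / 4) +
        (k₂.divisors.card : ℝ) * (∑ d ∈ k₁.divisors, Real.log d * Real.log ((k₁ / d : ℕ) : ℝ)) +
        (k₁.divisors.card : ℝ) * (∑ e ∈ k₂.divisors, Real.log e * Real.log ((k₂ / e : ℕ) : ℝ))) *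
        H (g * g * (k₁ * k₂)) := by
  rw [Finset.sum_congr rfl fun d hd ↦ Finset.sum_congr rfl fun e he ↦ by
    rw [n1_mul_n2_eq g hd he, log_Q_div_n1_eq hQ hg hd he, log_Q_div_n2_eq hQ hg hd he]]
  simp_rw [← Finset.sum_mul]
  rw [sum_divisors_sum_divisors_A1_mul_A2_eq_L _ hk₁ hk₂]

/-- Piece `(a,b) = (0,0)`, squarefree `k₁, k₂`: **`Σ_{d,e} log(Q/n₁)log(Q/n₂)·H(n₁n₂) =
τ(k₁)τ(k₂)·(L²/4 − (P₂(k₁)+P₂(k₂))/4)·H(g²k₁k₂)`** (`Q > 0`, `g ≥ 1`).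
[cite: KowalskiMichelVanderKam2000, (23)–(28) — derivation] -/
theorem inner_weight_A1A2_of_squarefree (H : ℕ → ℝ) {Q : ℝ} (hQ : 0 < Q) {g k₁ k₂ : ℕ} (hg : g ≠ 0)
    (hk₁ : Squarefree k₁) (hk₂ : Squarefree k₂) :
    ∑ d ∈ k₁.divisors, ∑ e ∈ k₂.divisors,
        Real.log (Q / ((k₁ / d * (g * e) : ℕ) : ℝ)) * Real.log (Q / ((g * d * (k₂ / e) : ℕ) : ℝ)) *
          H (k₁ / d * (g * e) * (g * d * (k₂ / e))) =
      (k₁.divisors.card : ℝ) * (k₂.divisors.card : ℝ) *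
        ((2 * (Real.log Q - Real.log g) - Real.log k₁ - Real.log k₂) ^ 2 / 4 -
          ((∑ p ∈ k₁.primeFactors, Real.log p ^ 2) + ∑ p ∈ k₂.primeFactors, Real.log p ^ 2) / 4) *
        H (g * g * (k₁ * k₂)) := by
  rw [Finset.sum_congr rfl fun d hd ↦ Finset.sum_congr rfl fun e he ↦ by
    rw [n1_mul_n2_eq g hd he, log_Q_div_n1_eq hQ hg hd he, log_Q_div_n2_eq hQ hg hd he]]
  simp_rw [← Finset.sum_mul]
  rw [sum_divisors_sum_divisors_A1_mul_A2_of_squarefree _ hk₁ hk₂]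

/-! ### Only squarefree `k₁, k₂` count inside the Selberg form -/

/-- **Inside the decorated Selberg form only squarefree `k₁, k₂` count**: if two inner weights `F, F'` (functions of
`c, g, k₁, k₂`) agree whenever `k₁` and `k₂` are squarefree, the Selberg forms agree (`μ(cgk) = 0` for non-squarefree `k`).
[folklore] -/
theorem selbergForm_congr_squarefree (P : ℝ[X]) (M : ℝ) (N : ℕ) (F F' : ℕ → ℕ → ℕ → ℕ → ℝ)
    (h : ∀ c g k₁ k₂ : ℕ, Squarefree k₁ → Squarefree k₂ → F c g k₁ k₂ = F' c g k₁ k₂) :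
    ∑ c ∈ Icc 1 N, ∑ g ∈ Icc 1 (N / c), (μ g : ℝ) * c *
        ∑ k₁ ∈ Icc 1 (N / (c * g)), ∑ k₂ ∈ Icc 1 (N / (c * g)),
          ((μ (c * g * k₁) : ℝ) * ((psi (c * g * k₁))⁻¹ *
              P.eval (Real.log (M / ((c * g * k₁ : ℕ) : ℝ)) / Real.log M)) / ((c * g * k₁ : ℕ) : ℝ)) *
            ((μ (c * g * k₂) : ℝ) * ((psi (c * g * k₂))⁻¹ *
              P.eval (Real.log (M / ((c * g * k₂ : ℕ) : ℝ)) / Real.log M)) / ((c * g * k₂ : ℕ) : ℝ)) *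
            F c g k₁ k₂ =
      ∑ c ∈ Icc 1 N, ∑ g ∈ Icc 1 (N / c), (μ g : ℝ) * c *
        ∑ k₁ ∈ Icc 1 (N / (c * g)), ∑ k₂ ∈ Icc 1 (N / (c * g)),
          ((μ (c * g * k₁) : ℝ) * ((psi (c * g * k₁))⁻¹ *
              P.eval (Real.log (M / ((c * g * k₁ : ℕ) : ℝ)) / Real.log M)) / ((c * g * k₁ : ℕ) : ℝ)) *
            ((μ (c * g * k₂) : ℝ) * ((psi (c * g * k₂))⁻¹ *
              P.eval (Real.log (M / ((c * g * k₂ : ℕ) : ℝ)) / Real.log M)) / ((c * g * k₂ : ℕ) : ℝ)) *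
            F' c g k₁ k₂ := by
  refine Finset.sum_congr rfl fun c _ ↦ Finset.sum_congr rfl fun g _ ↦ ?_
  congr 1
  refine Finset.sum_congr rfl fun k₁ _ ↦ Finset.sum_congr rfl fun k₂ _ ↦ ?_
  by_cases h₁ : Squarefree k₁
  · by_cases h₂ : Squarefree k₂
    · rw [h c g k₁ k₂ h₁ h₂]
    · have hμ : μ (c * g * k₂) = 0 := by
        rw [ArithmeticFunction.moebius_eq_zero_of_not_squarefree]
        exact fun hs ↦ h₂ (Squarefree.squarefree_of_dvd (Dvd.intro_left _ rfl) hs)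
      simp [hμ]
  · have hμ : μ (c * g * k₁) = 0 := by
      rw [ArithmeticFunction.moebius_eq_zero_of_not_squarefree]
      exact fun hs ↦ h₁ (Squarefree.squarefree_of_dvd (Dvd.intro_left _ rfl) hs)
    simp [hμ]

end Summit.Parity.GeneralizedHardyLittlewood.Theorems.MomentsBeyondDiagonal.DiagKernel

end
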